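import Literature.Computability.Complexity.TCResidueLayer
import Literature.Computability.Cryptography.NaorReingoldDDH
import HarnessLib

/-!
# The Naor–Reingold functions in `TC⁰`, I: the arithmetic of the two multiple products

Towards `Literature.Computability.Cryptography.NaorReingold2004_thm45` (Naor–Reingold 2004,
Thm. 4.5: the functions `f_{P,Q,g,ā}(x) = g^{a₀ ∏_{xᵢ=1} aᵢ}` of Construction 4.1 are computed by
constant-depth polynomial-size threshold circuits). This file contains the ARITHMETIC of the
evaluation along the lines of §4.2–4.2.1 of the paper (two multiple products modulo a prime,
each by Chinese remaindering; the first product is only needed in CRT representation), phrased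
for the layers of `TCResidueLayer.lean`:

* Stage A: the exponent `E(x) = a₀ ∏_{xᵢ=1} a_{i+1}` is the selected product
  `prodSel (a 0) (a ∘ succ) x` and `f(x) = g^{E(x)}` (`nrFun_eq_pow_expo`); `E(x) < 2^{n(n+1)}`.
* Stage B (`factorB`, `cast_prodB`): with the CRT data of `E` modulo the primes of
  `S₁ = primeSet (n(n+1))` — one-hot residues `[E mod p = ρ]` and the one-hot code of the
  quotient sum `σ` (so that `κ = (σ + |S₁|)/2^b`, `∑_p crtT p (E mod p) = κ M + E`) — the group
  element `g^E` is the SELECTED PRODUCT of the hard-wired powers `g^{crtT p ρ}` and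
  `g^{(Q − M mod Q) κ}` (as `g^Q = 1`): `g^{E} = g^{κM + E} · g^{(Q - M mod Q) κ}`.
* Stage D (`numD`, `cast_wsum_numD`, `wsum_numD_lt`): with the CRT data of that second product
  `Π₂` modulo the primes of `S₂`, the number `U = ∑_p (crtT p (Π₂ mod p) mod P) + κ₂ (P − M₂ mod P)`
  — a weighted sum of the wires with hard-wired weights — satisfies `U ≡ Π₂ ≡ f(x) (mod P)` and
  `U < (2|S₂| + 1) P` (the bits of `U mod P` are then read off the candidates `2^W − q P + U` in
  the assembly file).

No circuits in this file; the circuit is assembled in the companion file `NaorReingoldTC0.lean`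
and its size bounded (proving `NaorReingold2004_thm45`) in `NaorReingoldTC0Size.lean` (both to
be landed after this file).

## References

* M. Naor, O. Reingold, *Number-theoretic constructions of efficient pseudo-random functions*,
  J. ACM 51 (2004) 231–262: Construction 4.1 (p. 245), §4.2 and §4.2.1 (pp. 251–252), Thm. 4.5.
* H. Vollmer, *Introduction to Circuit Complexity* (1999), §1.4.2, Thm. 1.40 (the CRT algorithm).
-/

noncomputable section

namespace Literature.Computability.Cryptography

open Finset Complexity Complexity.SmallPrimes

namespace NRTC0

variable {n P Q g : ℕ}

/-! ### Stage A: the exponent as a selected product -/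

/-- The exponent `E(x) = a₀ · ∏_{xᵢ = 1} a_{i+1}` of `f_{P,Q,g,ā}(x) = g^{E(x)}`, as a selected
product. [cite: NaorReingold2004, Construction 4.1 (p. 245)] -/
def expo (a : Fin (n + 1) → ℕ) (x : Fin n → Bool) : ℕ := prodSel (a 0) (fun i => a i.succ) x

/-- `f(x) = g^{E(x)}`. [cite: NaorReingold2004, Construction 4.1 (p. 245)] -/
theorem nrFun_eq_pow_expo (a : Fin (n + 1) → ℕ) (x : Fin n → Bool) :
    nrFun P g a x = (g : ZMod P) ^ expo a x := rfl

/-- `E(x) < 2^{n(n+1)}` when all `aᵢ < Q ≤ 2^n`. [folklore] -/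
theorem expo_lt {a : Fin (n + 1) → ℕ} (hQ : Q ≤ 2 ^ n) (ha : ∀ i, a i < Q) (x : Fin n → Bool) :
    expo a x < 2 ^ (n * (n + 1)) := by
  have h := prodSel_lt_two_pow (W := n) (A₀ := a 0) (A := fun i : Fin n => a i.succ)
    ((ha 0).trans_le hQ) (fun i => (ha _).trans_le hQ) x
  simpa [expo, Fintype.card_fin] using h

/-! ### Prime sets -/

/-- The bit size of the first product. [folklore] -/
def B₁ (n : ℕ) : ℕ := n * (n + 1)

/-- The first prime set: all primes `≤ primeBound (n(n+1))`. [folklore] -/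
def S₁ (n : ℕ) : Finset ℕ := primeSet (B₁ n)

/-- The first prime size bound. [folklore] -/
def L₁ (n : ℕ) : ℕ := SmallPrimes.primeBound (B₁ n)

/-- Members of a prime set are at most the prime bound (and prime: `mem_primeSet`). [folklore] -/
theorem primeSet_le (B : ℕ) : ∀ p ∈ primeSet B, p ≤ SmallPrimes.primeBound B :=
  fun _ hp => Nat.lt_succ_iff.1 (mem_primeSet.1 hp).1

/-! ### Stage B: `g^E` as a selected product of preprocessed powers -/

/-- The wires after the first CRT layer (one-hot quotient sum, then one-hot residues). [folklore] -/
abbrev WiresB (n : ℕ) : Type := Fin (quotRange (S₁ n).card) ⊕ ↥(S₁ n) × Fin (L₁ n + 1)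

/-- The hard-wired factors of the second product: for the quotient wire `v`, the power
`g^{(Q − M mod Q) κ_v}`, `κ_v = (v + |S₁|) / 2^b`; for the residue wire `(p, ρ)`, the power
`g^{crtT p ρ}` — all as canonical representatives `< P` ("the values `g^{2^i}`" preprocessed, in
CRT form). [cite: NaorReingold2004, §4.2 and §4.2.1 (pp. 251–252)] -/
def factorB (n P Q g : ℕ) : WiresB n → ℕ
  | Sum.inl v => ((g : ZMod P) ^ ((Q - crtM (S₁ n) % Q) *
      (((v : ℕ) + (S₁ n).card) / 2 ^ apxB (S₁ n)))).val
  | Sum.inr q => ((g : ZMod P) ^ crtT (S₁ n) q.1 q.2).val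

/-- `factorB` on a quotient wire. [folklore] -/
@[simp] theorem factorB_inl (v : Fin (quotRange (S₁ n).card)) :
    factorB n P Q g (Sum.inl v) = ((g : ZMod P) ^ ((Q - crtM (S₁ n) % Q) *
      (((v : ℕ) + (S₁ n).card) / 2 ^ apxB (S₁ n)))).val := rfl

/-- `factorB` on a residue wire. [folklore] -/
@[simp] theorem factorB_inr (q : ↥(S₁ n) × Fin (L₁ n + 1)) :
    factorB n P Q g (Sum.inr q) = ((g : ZMod P) ^ crtT (S₁ n) q.1 q.2).val := rfl

/-- The factors are `< P`. [folklore] -/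
theorem factorB_lt [NeZero P] (w : WiresB n) : factorB n P Q g w < P := by
  cases w <;> exact ZMod.val_lt _

/-- The second product `Π₂(x)`: the selected product of the factors along the stage-B wires. [cite: NaorReingold2004, §4.2 (p. 251)] -/
def prodB (n P Q g : ℕ) (a : Fin (n + 1) → ℕ) (x : Fin n → Bool) : ℕ :=
  prodSel 1 (factorB n P Q g) (crtWires (a 0) (fun i => a i.succ) (S₁ n) (L₁ n) x)

/-- A selected product of group elements along a ONE-HOT code picks the coded factor. [folklore] -/
theorem prod_ite_oneHot {M : Type*} [CommMonoid M] {R : ℕ} (v : Fin R) (f : Fin R → M) :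
    (∏ ρ : Fin R, if decide (v = ρ) = true then f ρ else 1) = f v := by
  rw [Finset.prod_eq_single v]
  · simp
  · intro ρ _ hρ
    simp [Ne.symm hρ]
  · simp

/-- A selected product along wires `Sum.elim u z` splits. [folklore] -/
theorem prodSel_one_sum_elim {α β : Type*} [Fintype α] [Fintype β] (A : α ⊕ β → ℕ)
    (u : α → Bool) (z : β → Bool) :
    prodSel 1 A (Sum.elim u z) =
      (∏ i, if u i = true then A (Sum.inl i) else 1) * ∏ k, if z k = true then A (Sum.inr k) else 1 := by
  unfold prodSel
  rw [one_mul, Fintype.prod_sum_type]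
  rfl

/-- Casting a selected product of canonical representatives back to `ZMod P`. [folklore] -/
theorem cast_prod_ite_val {γ : Type*} [Fintype γ] [NeZero P] (c : γ → Bool) (e : γ → ZMod P) :
    (((∏ i, if c i = true then (e i).val else 1 : ℕ)) : ZMod P) = ∏ i, if c i = true then e i else 1 := by
  rw [Nat.cast_prod]
  refine Finset.prod_congr rfl fun i _ => ?_
  split
  · exact ZMod.natCast_zmod_val _
  · exact Nat.cast_one

/-- A weighted sum along wires `Sum.elim u z` splits. [folklore] -/
theorem wsum_sum_elim {α β : Type*} [Fintype α] [Fintype β] (c : α ⊕ β → ℕ) (u : α → Bool)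
    (z : β → Bool) :
    wsum c (Sum.elim u z) = wsum (fun i => c (Sum.inl i)) u + wsum (fun k => c (Sum.inr k)) z := by
  unfold wsum
  rw [Fintype.sum_sum_type]
  rfl

/-- A weighted sum along the one-hot code of `σ < R` is the weight of `σ`. [folklore] -/
theorem wsum_oneHot_fin {R σ : ℕ} (hσ : σ < R) (c : Fin R → ℕ) :
    wsum c (fun v : Fin R => decide (σ = (v : ℕ))) = c ⟨σ, hσ⟩ := by
  unfold wsum
  rw [Finset.sum_eq_single ⟨σ, hσ⟩]
  · simp
  · intro v _ hv
    have : decide (σ = (v : ℕ)) = false := by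
      rw [decide_eq_false_iff_not]; intro e; exact hv (Fin.ext e.symm)
    dsimp only
    rw [this]; simp
  · simp

/-- **Stage B**: `Π₂(x) ≡ g^{E(x)} = f(x) (mod P)` — the exponent is recovered from its CRT data
inside the exponent of `g`, using `g^Q = 1`:
`∏_p g^{crtT p (E mod p)} · g^{(Q − M mod Q) κ} = g^{κ M + E + (Q − M mod Q) κ} = g^E`. [cite: NaorReingold2004, §4.2.1 (p. 252)] -/
theorem cast_prodB (h : IsDDHInstance n P Q g) {a : Fin (n + 1) → ℕ} (ha : ∀ i, a i < Q)
    (x : Fin n → Bool) : ((prodB n P Q g a x : ℕ) : ZMod P) = nrFun P g a x := by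
  haveI : NeZero P := ⟨h.prime_P.ne_zero⟩
  have hS : ∀ p ∈ S₁ n, p.Prime := fun _ hp => (mem_primeSet.1 hp).2
  have hSL : ∀ p ∈ S₁ n, p ≤ L₁ n := primeSet_le (B₁ n)
  have hQ2 : Q ≤ 2 ^ n := by
    have h1 : Q ≤ P - 1 := Nat.le_of_dvd (by have := h.prime_P.two_le; omega) h.dvd
    have h2 := h.lt_two_pow
    omega
  have hE : expo a x < 2 ^ B₁ n := expo_lt hQ2 ha x
  have h4 : 4 * prodSel (a 0) (fun i => a i.succ) x < crtM (S₁ n) := by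
    have hM := four_mul_two_pow_lt_primorial (B₁ n)
    rw [← prod_primeSet] at hM
    exact lt_trans (by unfold expo at hE; omega) hM
  -- the quotient and the CRT identity
  set σ := wsum (quotWt (S₁ n) (L₁ n)) (oneHotWires (resSel (a 0) (fun i => a i.succ) (S₁ n)
    (L₁ n)) x) with hσ
  have hσlt : σ < quotRange (S₁ n).card := wsum_quotWt_lt hS hSL x
  have hκ : crtK (S₁ n) (expo a x) = (σ + (S₁ n).card) / 2 ^ apxB (S₁ n) :=
    crtK_prodSel_eq hS hSL x h4
  have hsum : crtSum (S₁ n) (expo a x) = crtK (S₁ n) (expo a x) * crtM (S₁ n) + expo a x :=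
    crtSum_eq (S₁ n) hS (by unfold expo; omega)
  -- compute the product
  unfold prodB crtWires
  rw [prodSel_one_sum_elim, Nat.cast_mul]
  -- quotient part: exactly the wire `v = σ` is on
  have hq : (((∏ v : Fin (quotRange (S₁ n).card),
      if decide (σ = (v : ℕ)) = true then factorB n P Q g (Sum.inl v) else 1 : ℕ)) : ZMod P) =
      (g : ZMod P) ^ ((Q - crtM (S₁ n) % Q) * crtK (S₁ n) (expo a x)) := by
    have hc := cast_prod_ite_val (P := P) (fun v : Fin (quotRange (S₁ n).card) =>
      decide (σ = (v : ℕ))) fun v =>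
        (g : ZMod P) ^ ((Q - crtM (S₁ n) % Q) * (((v : ℕ) + (S₁ n).card) / 2 ^ apxB (S₁ n)))
    simp only [factorB_inl]
    rw [hc, hκ]
    have := prod_ite_oneHot (M := ZMod P) ⟨σ, hσlt⟩ fun v =>
      (g : ZMod P) ^ ((Q - crtM (S₁ n) % Q) * (((v : ℕ) + (S₁ n).card) / 2 ^ apxB (S₁ n)))
    rw [← this]
    refine Finset.prod_congr rfl fun v _ => ?_
    simp only [Fin.ext_iff, eq_comm]
  -- residue part: for each `p`, exactly the wire `ρ = E mod p` is on
  have hr : (((∏ q : ↥(S₁ n) × Fin (L₁ n + 1),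
      if oneHotWires (resSel (a 0) (fun i => a i.succ) (S₁ n) (L₁ n)) x q = true then
        factorB n P Q g (Sum.inr q) else 1 : ℕ)) : ZMod P) =
      (g : ZMod P) ^ crtSum (S₁ n) (expo a x) := by
    have hc := cast_prod_ite_val (P := P)
      (oneHotWires (resSel (a 0) (fun i => a i.succ) (S₁ n) (L₁ n)) x)
      fun q => (g : ZMod P) ^ crtT (S₁ n) q.1 q.2
    simp only [factorB_inr]
    rw [hc, Fintype.prod_prod_type, crtSum, ← Finset.prod_pow_eq_pow_sum,
      ← Finset.prod_coe_sort (S₁ n)]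
    refine Finset.prod_congr rfl fun p _ => ?_
    simp only [oneHotWires_apply]
    rw [prod_ite_oneHot (M := ZMod P) (resSel (a 0) (fun i => a i.succ) (S₁ n) (L₁ n) x p)
      fun ρ => (g : ZMod P) ^ crtT (S₁ n) p ρ, resSel_val x p (hS p p.2) (hSL p p.2)]
    rfl
  rw [hq, hr, ← pow_add, nrFun_eq_pow_expo, hsum]
  -- exponent arithmetic: `(Q - M % Q) κ + (κ M + E) = E + Q ((M / Q + 1) κ)`
  set κ := crtK (S₁ n) (expo a x)
  set M := crtM (S₁ n)
  have hMQ : M % Q + Q * (M / Q) = M := Nat.mod_add_div M Q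
  have hlt : M % Q < Q := Nat.mod_lt _ h.prime_Q.pos
  have hexp : (Q - M % Q) * κ + (κ * M + expo a x) = expo a x + Q * ((M / Q + 1) * κ) := by
    zify [hlt.le] at hMQ ⊢
    linear_combination (-(κ : ℤ)) * hMQ
  rw [hexp, pow_add, pow_mul, h.pow_eq_one, one_pow, mul_one]

/-- The bit bound `B₂ = n (card WiresB + 1)` for the second product `Π₂`: each of the
`card WiresB` selected factors, and the leading `1`, is `< P < 2^n`. [folklore] -/
def B₂ (n : ℕ) : ℕ := n * (Fintype.card (WiresB n) + 1)

/-- The bound on the second product. [folklore] -/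
theorem prodB_lt (h : IsDDHInstance n P Q g) (a : Fin (n + 1) → ℕ) (x : Fin n → Bool) :
    prodB n P Q g a x < 2 ^ B₂ n := by
  haveI : NeZero P := ⟨h.prime_P.ne_zero⟩
  exact prodSel_lt_two_pow (W := n) (lt_trans h.prime_P.one_lt h.lt_two_pow)
    (fun w => (factorB_lt w).trans h.lt_two_pow) _

/-! ### Stage C/D: the second CRT layer and the final weighted sum -/

/-- The second prime set. [folklore] -/
def S₂ (n : ℕ) : Finset ℕ := primeSet (B₂ n)

/-- The second prime size bound. [folklore] -/
def L₂ (n : ℕ) : ℕ := SmallPrimes.primeBound (B₂ n)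

/-- The wires after the second CRT layer. [folklore] -/
abbrev WiresD (n : ℕ) : Type := Fin (quotRange (S₂ n).card) ⊕ ↥(S₂ n) × Fin (L₂ n + 1)

/-- The stage-D wires as a function of the input. [folklore] -/
def wiresD (n P Q g : ℕ) (a : Fin (n + 1) → ℕ) (x : Fin n → Bool) : WiresD n → Bool :=
  crtWires 1 (factorB n P Q g) (S₂ n) (L₂ n) (crtWires (a 0) (fun i => a i.succ) (S₁ n) (L₁ n) x)

/-- The hard-wired summands of the final weighted sum `U`: the quotient wire `v` weighs
`κ_v (P − M₂ mod P)` (`≡ −κ_v M₂`), the residue wire `(p, ρ)` weighs `crtT p ρ mod P` ("the value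
`P` is also known in advance", so the final modular reduction works with preprocessed residues). [cite: NaorReingold2004, §4.2.1 (p. 252)] -/
def numD (n P : ℕ) : WiresD n → ℕ
  | Sum.inl v => (((v : ℕ) + (S₂ n).card) / 2 ^ apxB (S₂ n)) * (P - crtM (S₂ n) % P)
  | Sum.inr q => crtT (S₂ n) q.1 q.2 % P

/-- `numD` on a quotient wire. [folklore] -/
@[simp] theorem numD_inl (v : Fin (quotRange (S₂ n).card)) :
    numD n P (Sum.inl v) = (((v : ℕ) + (S₂ n).card) / 2 ^ apxB (S₂ n)) * (P - crtM (S₂ n) % P) :=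
  rfl

/-- `numD` on a residue wire. [folklore] -/
@[simp] theorem numD_inr (q : ↥(S₂ n) × Fin (L₂ n + 1)) :
    numD n P (Sum.inr q) = crtT (S₂ n) q.1 q.2 % P := rfl

/-- The stage-D wires in terms of the stage-B wires. [folklore] -/
theorem wiresD_eq (a : Fin (n + 1) → ℕ) (x : Fin n → Bool) :
    wiresD n P Q g a x = crtWires 1 (factorB n P Q g) (S₂ n) (L₂ n)
      (crtWires (a 0) (fun i => a i.succ) (S₁ n) (L₁ n) x) := rfl

/-- The second product in terms of the stage-B wires. [folklore] -/
theorem prodB_eq (a : Fin (n + 1) → ℕ) (x : Fin n → Bool) :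
    prodB n P Q g a x = prodSel 1 (factorB n P Q g)
      (crtWires (a 0) (fun i => a i.succ) (S₁ n) (L₁ n) x) := rfl

/-- The number of candidate quotients of the final reduction: `U < qmax · P`. [folklore] -/
def qmax (n : ℕ) : ℕ := 2 * (S₂ n).card + 1

/-- **Stage D, congruence**: `U(x) = ∑_w numD w · [wire w] ≡ Π₂(x) ≡ f(x) (mod P)`. [cite: NaorReingold2004, §4.2.1 (p. 252)] -/
theorem cast_wsum_numD (h : IsDDHInstance n P Q g) {a : Fin (n + 1) → ℕ} (ha : ∀ i, a i < Q)
    (x : Fin n → Bool) :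
    ((wsum (numD n P) (wiresD n P Q g a x) : ℕ) : ZMod P) = nrFun P g a x := by
  haveI : NeZero P := ⟨h.prime_P.ne_zero⟩
  have hS : ∀ p ∈ S₂ n, p.Prime := fun _ hp => (mem_primeSet.1 hp).2
  have hSL : ∀ p ∈ S₂ n, p ≤ L₂ n := primeSet_le (B₂ n)
  set y := crtWires (a 0) (fun i => a i.succ) (S₁ n) (L₁ n) x with hy
  have hPB : prodB n P Q g a x = prodSel 1 (factorB n P Q g) y := prodB_eq a x
  have hPi : prodSel 1 (factorB n P Q g) y < 2 ^ B₂ n := hPB ▸ prodB_lt h a x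
  have h4 : 4 * prodSel 1 (factorB n P Q g) y < crtM (S₂ n) := by
    have hM := four_mul_two_pow_lt_primorial (B₂ n)
    rw [← prod_primeSet] at hM
    exact lt_trans (by omega) hM
  set σ := wsum (quotWt (S₂ n) (L₂ n)) (oneHotWires (resSel 1 (factorB n P Q g) (S₂ n) (L₂ n)) y)
    with hσ
  have hσlt : σ < quotRange (S₂ n).card := wsum_quotWt_lt hS hSL y
  have hκ : crtK (S₂ n) (prodSel 1 (factorB n P Q g) y) = (σ + (S₂ n).card) / 2 ^ apxB (S₂ n) :=
    crtK_prodSel_eq hS hSL y h4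
  have hsum : crtSum (S₂ n) (prodSel 1 (factorB n P Q g) y) =
      crtK (S₂ n) (prodSel 1 (factorB n P Q g) y) * crtM (S₂ n) + prodSel 1 (factorB n P Q g) y :=
    crtSum_eq (S₂ n) hS (by omega)
  rw [← cast_prodB h ha x, hPB, wiresD_eq, ← hy]
  unfold crtWires
  rw [wsum_sum_elim, wsum_oneHot_fin hσlt, wsum_oneHotWires, numD_inl, Fin.val_mk, ← hκ,
    Nat.cast_add, Nat.cast_mul, Nat.cast_sum]
  have hm : ((P - crtM (S₂ n) % P : ℕ) : ZMod P) = -(crtM (S₂ n) : ZMod P) := by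
    have hlt : crtM (S₂ n) % P < P := Nat.mod_lt _ h.prime_P.pos
    rw [Nat.cast_sub hlt.le, ZMod.natCast_self, zero_sub, ZMod.natCast_mod]
  have hr : (∑ p : ↥(S₂ n), ((numD n P (Sum.inr (p, resSel 1 (factorB n P Q g) (S₂ n) (L₂ n) y p))
      : ℕ) : ZMod P)) = (crtSum (S₂ n) (prodSel 1 (factorB n P Q g) y) : ZMod P) := by
    rw [crtSum, ← Finset.sum_coe_sort (S₂ n), Nat.cast_sum]
    refine Finset.sum_congr rfl fun p _ => ?_
    rw [numD_inr, ZMod.natCast_mod, resSel_val y p (hS p p.2) (hSL p p.2)]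
  rw [hm, hr, hsum]
  push_cast
  ring

/-- **Stage D, size**: `U(x) < qmax · P`. [folklore] -/
theorem wsum_numD_lt (h : IsDDHInstance n P Q g) (a : Fin (n + 1) → ℕ) (x : Fin n → Bool) :
    wsum (numD n P) (wiresD n P Q g a x) < qmax n * P := by
  haveI : NeZero P := ⟨h.prime_P.ne_zero⟩
  have hS : ∀ p ∈ S₂ n, p.Prime := fun _ hp => (mem_primeSet.1 hp).2
  have hSL : ∀ p ∈ S₂ n, p ≤ L₂ n := primeSet_le (B₂ n)
  have hP := h.prime_P.pos
  set y := crtWires (a 0) (fun i => a i.succ) (S₁ n) (L₁ n) x with hy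
  set σ := wsum (quotWt (S₂ n) (L₂ n)) (oneHotWires (resSel 1 (factorB n P Q g) (S₂ n) (L₂ n)) y)
    with hσ
  have hσlt : σ < quotRange (S₂ n).card := wsum_quotWt_lt hS hSL y
  have hPB : prodB n P Q g a x = prodSel 1 (factorB n P Q g) y := prodB_eq a x
  have hPi : prodSel 1 (factorB n P Q g) y < 2 ^ B₂ n := hPB ▸ prodB_lt h a x
  have h4 : 4 * prodSel 1 (factorB n P Q g) y < crtM (S₂ n) := by
    have hM := four_mul_two_pow_lt_primorial (B₂ n)
    rw [← prod_primeSet] at hM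
    exact lt_trans (by omega) hM
  have hκ : crtK (S₂ n) (prodSel 1 (factorB n P Q g) y) = (σ + (S₂ n).card) / 2 ^ apxB (S₂ n) :=
    crtK_prodSel_eq hS hSL y h4
  have hκlt : (σ + (S₂ n).card) / 2 ^ apxB (S₂ n) < (S₂ n).card + 1 := by
    rw [← hκ]; exact crtK_lt (S₂ n) hS _
  rw [wiresD_eq, ← hy]
  unfold crtWires
  rw [wsum_sum_elim, wsum_oneHot_fin hσlt, wsum_oneHotWires, numD_inl, Fin.val_mk]
  have hq : (σ + (S₂ n).card) / 2 ^ apxB (S₂ n) * (P - crtM (S₂ n) % P) ≤ (S₂ n).card * P :=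
    Nat.mul_le_mul (Nat.lt_succ_iff.1 hκlt) (Nat.sub_le _ _)
  have hr : (∑ p : ↥(S₂ n), numD n P (Sum.inr (p, resSel 1 (factorB n P Q g) (S₂ n) (L₂ n) y p)))
      ≤ (S₂ n).card * (P - 1) := by
    calc (∑ p : ↥(S₂ n), numD n P (Sum.inr (p, resSel 1 (factorB n P Q g) (S₂ n) (L₂ n) y p)))
        ≤ ∑ _p : ↥(S₂ n), (P - 1) := Finset.sum_le_sum fun p _ => by
          rw [numD_inr]
          exact Nat.le_sub_one_of_lt (Nat.mod_lt _ hP)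
      _ = (S₂ n).card * (P - 1) := by simp
  have : (S₂ n).card * (P - 1) ≤ (S₂ n).card * P := Nat.mul_le_mul_left _ (Nat.sub_le _ _)
  calc _ ≤ (S₂ n).card * P + (S₂ n).card * P := add_le_add hq (hr.trans this)
    _ < (S₂ n).card * P + (S₂ n).card * P + P := Nat.lt_add_of_pos_right hP
    _ = qmax n * P := by unfold qmax; ring

/-- **Stage D, bits**: `f(x) = U(x) mod P` as a natural number. [cite: NaorReingold2004, §4.2.1 (p. 252)] -/
theorem val_nrFun_eq (h : IsDDHInstance n P Q g) {a : Fin (n + 1) → ℕ} (ha : ∀ i, a i < Q)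
    (x : Fin n → Bool) : (nrFun P g a x).val = wsum (numD n P) (wiresD n P Q g a x) % P := by
  rw [← cast_wsum_numD h ha x, ZMod.val_natCast]

end NRTC0

end Literature.Computability.Cryptography

end
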